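import Literature.NumberTheory.GaloisCohomology.Howard2004.ResidualLevelControlLocalProofs
import Literature.NumberTheory.GaloisCohomology.Howard2004.ResidualSelmerEigenpartsProofs
import Literature.NumberTheory.GaloisCohomology.Howard2004.DVRSettingEngineSmallProofs
import Literature.NumberTheory.GaloisCohomology.Howard2004.DVRSettingLevelTrivialityProofs
import Literature.Algebra.Module.EigenLengthCount
import HarnessLib

/-!
# Howard 2004, Def. 1.5.2 / Lemma 1.6.4 on a `DVRSetting`: the count
# `ρ(n) = ρ(n)⁺ + ρ(n)⁻ = dim_{R/𝔪} H¹_{F(n)}(K, T^{(k)})[𝔪]` READ ON THE LEVEL MODULE (proofs file, ENGINE ρ-identity)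

Topic `NumberTheory/GaloisCohomology/Howard2004` (sequel to `ResidualLevelControlLocalProofs` — Lemma 1.3.3's additive
bijection `H¹_{F̄(n)}(K, T̄) ≃+ H¹_{F(n)}(K, T^{(k)}) ⊓ ker(π·)` —, to `ResidualSelmerEigenpartsProofs` — `τ_*` acts on
`H¹_{F̄(n)}(K, T̄)`, which splits into its `±`-eigenparts, `p` odd —, to `DVRSettingEngineSmallProofs` — the engine binder
`hsmall` modulo the comparison `dim H¹_{F(n)}(K,T^{(k)})[π] ≤ ρ⁺ + ρ⁻` — and to the algebra
`Literature/Algebra/Module/EigenLengthCount` (`len (P ⊔ Q) = len P + len Q` for disjoint submodules)).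
THEOREMS ONLY: no definition, no named fact, no instance, no notation, no `sorry`.

B. Howard, *The Heegner point Kolyvagin system*, Compositio Math. **140** (2004) 1439–1472 = arXiv:1202.6340.
Def. 1.5.2 (arXiv p. 9 L133–138): «`ρ(n)^±` = the `R/𝔪`-dimension of `𝓗̄(n)^±`, `ρ(n) = ρ(n)⁺ + ρ(n)⁻ = dim 𝓗̄(n)`»;
proof of Lemma 1.6.4 (arXiv p. 11 L95–97, p. 12 L10–13): «By Lemma 1.3.3 [(H.5 application)], `ρ(n)` is the
`R/𝔪`-dimension of `H¹_{F(n)}(K, T^{(k)})[𝔪]` … `ρ(n) = 0` or `1` implies `Stub^{(k)}(n) = H¹_{F(n)}(K, T^{(k)})`».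
On a `DVRSetting S` with `hy : S.SatisfiesH`, at level `k` and `n ⊆ 𝓛^{(2k-1)}` (`S.enginePrimes k`), with
`Ē(n) := H¹_{F̄_k(n)}(K, T̄)` (`F̄_k(n) = ((hy.h1 k).1.propagateStructure (S.t k).cond).modify 𝒯̄ ∅ ∅ n`, the structure of
`ResidualLevelControlProofs` / `ResidualSelmerEigenpartsProofs`), `τ_* = semilinearH … (S.A k).θ …`, and the eigenparts
`Ē(n)^± = Ē(n) ⊓ ker(τ_* ∓ 1)` read as `R_k`-submodules by `galoisCohomology.submoduleOfStable` (the stability witnesses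
`scalarMapH1_mem_residualSelmer_inf_ker_sub` / `_add` of `ResidualSelmerEigenpartsProofs` §2 — the ρ± currency of the
ENGINE-hcheb bricks):

* §1 **`length_torsionBy_selmerModuleAt_eq_length_residualSelmer`** — `len_R H¹_{F(n)}(K,T^{(k)})[π] = len_{R_k} Ē(n)`:
  Lemma 1.3.3's bijection (`exists_addEquiv_selmerGroup_residual_atLevel`, its `htriv` discharged by
  `htriv_of_subset_enginePrimes`, `ι` by `exists_residualInclusion`) is SEMILINEAR over the surjection `R ↠ R_k`
  (`cohomologyMap_residualInclusion_scalarMapH1`, `scalarMapH1_algebraMap_eq`), hence an order isomorphism of the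
  submodule lattices (`Submodule.orderIsoMapComapOfBijective`) — no finiteness needed.
* §2 **`length_residualSelmer_eq_add`** — `len Ē(n) = len Ē(n)⁺ + len Ē(n)⁻`: `Ē(n) = Ē(n)⁺ ⊕ Ē(n)⁻` internally
  (`exists_eigen_decomposition_mem`; `Ē⁺ ⊓ Ē⁻ = 0` as `2` and `p` both kill it, `p` odd).
* §3 **`length_torsionBy_selmerModuleAt_eq`** — THE ρ-IDENTITY in `ℕ∞`, unconditional:
  `len_R H¹_{F(n)}(K,T^{(k)})[π] = len_{R_k} Ē(n)⁺ + len_{R_k} Ē(n)⁻`.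
* §4 the engine letters: **`finrank_torsionBy_selmerModuleAt_eq_add`** (`dim_{R/(π)} H¹_{F(n)}(K,T^{(k)})[π] = ρ⁺ k n + ρ⁻ k n`
  for any `ℕ`-valued `ρ±` equal to those lengths — the `hρ`/`hpar` supplier of `hsmall_of_finrank_le` and of Prop. 1.5.5's
  `ε`-constancy) and **`hsmall_of_eigenLengths`** (the ENGINE binder `hsmall` VERBATIM for such `ρ±`).

Cell `pub/bsd-print-x9`, G87 = Howard Thm. 1.6.1 (print leaf `stub_h161` of stmt-BirchSwinnertonDyer-22642); seat
`bsd-line-x10b-p1-w8` g11, brick (RHO-ID).  HONEST FRAMING: `thm161_dvrKolyvaginBound` is NOT proved here; the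
Lemma 1.5.3 parity `ρ(nq)^± = ρ(n)^± ± 1` is NOT here; no summit statement is proved; BSD is not proved by any of this.

References: [Howard2004HeegnerKolyvagin] Def. 1.5.2, Lemma 1.3.3, Lemma 1.6.4 (proof); [MazurRubinMemoirs2004] Lemma 3.5.4.
-/

set_option autoImplicit false

noncomputable section

open Function NumberField IsDedekindDomain Field Module Submodule
open scoped NumberField ContRepresentation Classical Pointwise

namespace Literature.NumberTheory.GaloisCohomology.Howard2004

open Literature.NumberTheory.GaloisRepresentations
open Literature.NumberTheory.GaloisRepresentations.DiscreteGaloisModule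
open Literature.NumberTheory.GaloisRepresentations.galoisCohomology
open Literature.NumberTheory.EllipticCurves
open Literature.Algebra.Module

namespace DVRSetting

variable {p : ℕ} [Fact p.Prime] {K : Type} [Field K] [NumberField K]
  {R : Type} [CommRing R] [IsDomain R] [IsDiscreteValuationRing R] [Algebra ℤ_[p] R]
  {N : ℕ → Type} [∀ k, AddCommGroup (N k)] [∀ k, TopologicalSpace (N k)]
  [∀ k, DiscreteTopology (N k)] [∀ k, Module R (N k)]
  {Rk : ℕ → Type} [∀ k, CommRing (Rk k)] [∀ k, IsLocalRing (Rk k)] [∀ k, TopologicalSpace (Rk k)]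
  [∀ k, DiscreteTopology (Rk k)] [∀ k, Algebra ℤ_[p] (Rk k)] [∀ k, Algebra R (Rk k)]
  [∀ k, Module (Rk k) (N k)] [∀ k, IsScalarTower R (Rk k) (N k)]
  {Nbar : Type} [AddCommGroup Nbar] [TopologicalSpace Nbar] [DiscreteTopology Nbar]
  [∀ k, Module (Rk k) Nbar]
  {Nq : ℕ → Finset (HeightOneSpectrum (𝓞 K)) → Type} [∀ k n, AddCommGroup (Nq k n)]
  [∀ k n, TopologicalSpace (Nq k n)] [∀ k n, DiscreteTopology (Nq k n)]
  [∀ k n, Module (Rk k) (Nq k n)] [∀ k n, Module R (Nq k n)]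
  [∀ k n, IsScalarTower R (Rk k) (Nq k n)]

/-! ## §1 `len_R H¹_{F(n)}(K, T^{(k)})[π] = len_{R_k} H¹_{F̄(n)}(K, T̄)` (Lemma 1.3.3, read on the lattices) -/

/-- **Lemma 1.3.3 «(H.5 application)» as an equality of lengths**: for `n ⊆ 𝓛^{(2k-1)}`,
`len_R (H¹_{F(n)}(K, T^{(k)})[π]) = len_{R_k} H¹_{F̄(n)}(K, T̄)` — the additive bijection
`H¹_{F̄(n)}(K, T̄) ≃+ H¹_{F(n)}(K, T^{(k)}) ⊓ ker(π·)` of `exists_addEquiv_selmerGroup_residual_atLevel` (underlying map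
`H¹(K, ι)`) intertwines the `R_k`-scalars with the `R`-scalars through `R ↠ R_k`, so it is a bijective map semilinear
over a surjective ring map and the two submodule lattices are isomorphic (no finiteness is used: both sides may be `⊤`).
Howard: «`ρ(n)` is the `R/𝔪`-dimension of `H¹_{F(n)}(K, T̄) ≅ H¹_{F(n)}(K, T^{(k)})[𝔪]`».
[cite: Howard2004HeegnerKolyvagin, Lemma 1.3.3 and Lemma 1.6.4 proof (arXiv:1202.6340 p. 7 L152–160, p. 11 L95–97)] [cite: MazurRubinMemoirs2004, Lemma 3.5.4] -/
theorem length_torsionBy_selmerModuleAt_eq_length_residualSelmer (S : DVRSetting p K R N Rk Nbar Nq)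
    (hy : S.SatisfiesH) (k : ℕ) (n : Finset (HeightOneSpectrum (𝓞 K))) (hn : ↑n ⊆ S.enginePrimes k) :
    letI := galoisCohomology.moduleH1 (S.T.ρ k) (S.T.hlin k)
    letI := galoisCohomology.moduleH1 S.ρbar (S.isScalarLinear_rhobar hy k)
    Module.length R ↥(torsionBy R ↥(S.selmerModuleAt hy k n) S.π) =
      Module.length (Rk k) ↥(galoisCohomology.submoduleOfStable (S.isScalarLinear_rhobar hy k)
        ((((hy.h1 k).1.propagateStructure (S.t k).cond).modify (transverseStructure p S.ρbar S.jbar)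
          ∅ ∅ n).selmerGroup)
        (S.scalarMapH1_mem_residualSelmer_modify hy k ∅ ∅ n)) := by
  letI instR := galoisCohomology.moduleH1 (S.T.ρ k) (S.T.hlin k)
  letI instRk := galoisCohomology.moduleH1 S.ρbar (S.isScalarLinear_rhobar hy k)
  -- the residual inclusion `ι : T̄ → T^{(k)}` and Lemma 1.3.3's bijection `Θ`
  obtain ⟨ι, hι⟩ := S.exists_residualInclusion hy k
  have hequiv : ∀ (σ : absoluteGaloisGroup K) (x : Nbar), ι (S.ρbar σ x) = S.T.ρ k σ (ι x) :=
    S.residualInclusion_equivariant hy k ι hι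
  have hek : S.e k ≤ 2 * S.e k - 1 := by have := S.one_le_e hy k; omega
  obtain ⟨Θ, hΘ⟩ := S.exists_addEquiv_selmerGroup_residual_atLevel hy k ι hι hequiv n
    (S.htriv_of_subset_enginePrimes hy hn k hek)
  -- the two functorial scalar actions, unfolded
  have hsmulR : ∀ (r : R) (c : galoisCohomology (S.T.ρ k) 1),
      r • c = galoisCohomology.scalarMapH1 (S.T.ρ k) (S.T.hlin k) r c := fun _ _ => rfl
  have hsmulRk : ∀ (a : Rk k) (c : galoisCohomology S.ρbar 1),
      a • c = galoisCohomology.scalarMapH1 S.ρbar (S.isScalarLinear_rhobar hy k) a c := fun _ _ => rfl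
  -- an element of `H[π]` is a class of `H¹_{F(n)}(K, T^{(k)}) ⊓ ker(π·)`
  have hmem : ∀ x : ↥(torsionBy R ↥(S.selmerModuleAt hy k n) S.π),
      (((x : ↥(S.selmerModuleAt hy k n)) : galoisCohomology (S.T.ρ k) 1)) ∈
        (((S.t k).atLevel S.jbar n).cond).selmerGroup ⊓
          (galoisCohomology.scalarMapH1 (S.T.ρ k) (S.T.hlin k) S.π).ker := by
    intro x
    refine AddSubgroup.mem_inf.2 ⟨(S.mem_selmerModuleAt_iff hy k n _).1 (x : ↥(S.selmerModuleAt hy k n)).2, ?_⟩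
    have hx : S.π • (x : ↥(S.selmerModuleAt hy k n)) = 0 := (Submodule.mem_torsionBy_iff _ _).1 x.2
    have hx' := congrArg Subtype.val hx
    rw [Submodule.coe_smul, hsmulR, Submodule.coe_zero] at hx'
    exact (AddMonoidHom.mem_ker).2 hx'
  -- Lemma 1.3.3: the class `x ∈ H[π]` is `H¹(K, ι)` of the residual class `Θ⁻¹ x`
  have hAx : ∀ x : ↥(torsionBy R ↥(S.selmerModuleAt hy k n) S.π),
      (((x : ↥(S.selmerModuleAt hy k n)) : galoisCohomology (S.T.ρ k) 1)) =
        ContinuousRep.cohomologyMap S.ρbar (S.T.ρ k) ι.toAddMonoidHom continuous_of_discreteTopology hequiv 1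
          ((Θ.symm ⟨_, hmem x⟩ :
              ↥((((hy.h1 k).1.propagateStructure (S.t k).cond).modify (transverseStructure p S.ρbar S.jbar)
                ∅ ∅ n).selmerGroup)) : galoisCohomology S.ρbar 1) := by
    intro x
    have h := hΘ (Θ.symm ⟨_, hmem x⟩)
    rw [AddEquiv.apply_symm_apply] at h
    exact h
  -- `Θ⁻¹ : H[π] → H¹_{F̄(n)}(K, T̄)` is semilinear over `R ↠ R_k` and bijective
  let f : ↥(torsionBy R ↥(S.selmerModuleAt hy k n) S.π) →ₛₗ[algebraMap R (Rk k)]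
      ↥(galoisCohomology.submoduleOfStable (S.isScalarLinear_rhobar hy k)
        ((((hy.h1 k).1.propagateStructure (S.t k).cond).modify (transverseStructure p S.ρbar S.jbar)
          ∅ ∅ n).selmerGroup)
        (S.scalarMapH1_mem_residualSelmer_modify hy k ∅ ∅ n)) :=
    { toFun := fun x => ⟨(Θ.symm ⟨_, hmem x⟩ : galoisCohomology S.ρbar 1), (Θ.symm ⟨_, hmem x⟩).2⟩
      map_add' := fun x y => by
        apply Subtype.ext
        have hA : (⟨_, hmem (x + y)⟩ : ↥((((S.t k).atLevel S.jbar n).cond).selmerGroup ⊓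
            (galoisCohomology.scalarMapH1 (S.T.ρ k) (S.T.hlin k) S.π).ker)) = ⟨_, hmem x⟩ + ⟨_, hmem y⟩ :=
          Subtype.ext rfl
        show ((Θ.symm ⟨_, hmem (x + y)⟩ :
            ↥((((hy.h1 k).1.propagateStructure (S.t k).cond).modify (transverseStructure p S.ρbar S.jbar)
              ∅ ∅ n).selmerGroup)) : galoisCohomology S.ρbar 1) =
          (Θ.symm ⟨_, hmem x⟩ : galoisCohomology S.ρbar 1) + (Θ.symm ⟨_, hmem y⟩ : galoisCohomology S.ρbar 1)
        rw [hA, map_add]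
        rfl
      map_smul' := fun r x => by
        apply Subtype.ext
        show ((Θ.symm ⟨_, hmem (r • x)⟩ :
            ↥((((hy.h1 k).1.propagateStructure (S.t k).cond).modify (transverseStructure p S.ρbar S.jbar)
              ∅ ∅ n).selmerGroup)) : galoisCohomology S.ρbar 1) =
          galoisCohomology.scalarMapH1 S.ρbar (S.isScalarLinear_rhobar hy k) (algebraMap R (Rk k) r)
            ((Θ.symm ⟨_, hmem x⟩ :
              ↥((((hy.h1 k).1.propagateStructure (S.t k).cond).modify (transverseStructure p S.ρbar S.jbar)
                ∅ ∅ n).selmerGroup)) : galoisCohomology S.ρbar 1)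
        have hstab := S.scalarMapH1_mem_residualSelmer_modify hy k ∅ ∅ n (algebraMap R (Rk k) r)
          (Θ.symm ⟨_, hmem x⟩).2
        have key : (⟨_, hmem (r • x)⟩ : ↥((((S.t k).atLevel S.jbar n).cond).selmerGroup ⊓
            (galoisCohomology.scalarMapH1 (S.T.ρ k) (S.T.hlin k) S.π).ker)) = Θ ⟨_, hstab⟩ := by
          apply Subtype.ext
          calc (((r • x : ↥(torsionBy R ↥(S.selmerModuleAt hy k n) S.π)) : ↥(S.selmerModuleAt hy k n)) :
                galoisCohomology (S.T.ρ k) 1)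
              = galoisCohomology.scalarMapH1 (S.T.ρ k) (S.T.hlin k) r
                  ((x : ↥(S.selmerModuleAt hy k n)) : galoisCohomology (S.T.ρ k) 1) := by
                rw [Submodule.coe_smul, Submodule.coe_smul, hsmulR]
            _ = galoisCohomology.scalarMapH1 (S.T.ρ k) (hy.scalarLinear k) (algebraMap R (Rk k) r)
                  ((x : ↥(S.selmerModuleAt hy k n)) : galoisCohomology (S.T.ρ k) 1) :=
                (S.scalarMapH1_algebraMap_eq hy k r _).symm
            _ = galoisCohomology.scalarMapH1 (S.T.ρ k) (hy.scalarLinear k) (algebraMap R (Rk k) r)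
                  (ContinuousRep.cohomologyMap S.ρbar (S.T.ρ k) ι.toAddMonoidHom continuous_of_discreteTopology
                    hequiv 1 ((Θ.symm ⟨_, hmem x⟩ :
                      ↥((((hy.h1 k).1.propagateStructure (S.t k).cond).modify
                        (transverseStructure p S.ρbar S.jbar) ∅ ∅ n).selmerGroup)) : galoisCohomology S.ρbar 1)) :=
                congrArg (fun z : galoisCohomology (S.T.ρ k) 1 =>
                  galoisCohomology.scalarMapH1 (S.T.ρ k) (hy.scalarLinear k) (algebraMap R (Rk k) r) z) (hAx x)
            _ = @id (galoisCohomology (S.T.ρ k) 1) (ContinuousRep.cohomologyMap S.ρbar (S.T.ρ k)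
                  ι.toAddMonoidHom continuous_of_discreteTopology
                  hequiv 1 (galoisCohomology.scalarMapH1 S.ρbar (S.isScalarLinear_rhobar hy k)
                    (algebraMap R (Rk k) r) ((Θ.symm ⟨_, hmem x⟩ :
                      ↥((((hy.h1 k).1.propagateStructure (S.t k).cond).modify
                        (transverseStructure p S.ρbar S.jbar) ∅ ∅ n).selmerGroup)) : galoisCohomology S.ρbar 1))) :=
                (S.cohomologyMap_residualInclusion_scalarMapH1 hy k ι hequiv _ _).symm
            _ = _ := (hΘ ⟨_, hstab⟩).symm
        rw [key, AddEquiv.symm_apply_apply] }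
  have hf : Function.Bijective f := by
    constructor
    · intro x y hxy
      have h1 : Θ.symm ⟨_, hmem x⟩ = Θ.symm ⟨_, hmem y⟩ := Subtype.ext (congrArg Subtype.val hxy)
      have h2 := congrArg Subtype.val (Θ.symm.injective h1)
      exact Subtype.ext (Subtype.ext h2)
    · intro e
      have he : (e : galoisCohomology S.ρbar 1) ∈
          (((hy.h1 k).1.propagateStructure (S.t k).cond).modify (transverseStructure p S.ρbar S.jbar)
            ∅ ∅ n).selmerGroup :=
        (galoisCohomology.mem_submoduleOfStable_iff _ _ _ _).1 e.2
      have hdH : ((Θ ⟨_, he⟩ : ↥((((S.t k).atLevel S.jbar n).cond).selmerGroup ⊓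
          (galoisCohomology.scalarMapH1 (S.T.ρ k) (S.T.hlin k) S.π).ker)) : galoisCohomology (S.T.ρ k) 1) ∈
            S.selmerModuleAt hy k n :=
        (S.mem_selmerModuleAt_iff hy k n _).2 (AddSubgroup.mem_inf.1 (Θ ⟨_, he⟩).2).1
      have hdπ : (⟨_, hdH⟩ : ↥(S.selmerModuleAt hy k n)) ∈ torsionBy R ↥(S.selmerModuleAt hy k n) S.π := by
        rw [Submodule.mem_torsionBy_iff]
        apply Subtype.ext
        rw [Submodule.coe_smul, hsmulR, Submodule.coe_zero]
        exact (AddMonoidHom.mem_ker).1 (AddSubgroup.mem_inf.1 (Θ ⟨_, he⟩).2).2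
      refine ⟨⟨_, hdπ⟩, Subtype.ext ?_⟩
      have hA : (⟨_, hmem ⟨_, hdπ⟩⟩ : ↥((((S.t k).atLevel S.jbar n).cond).selmerGroup ⊓
          (galoisCohomology.scalarMapH1 (S.T.ρ k) (S.T.hlin k) S.π).ker)) = Θ ⟨_, he⟩ := Subtype.ext rfl
      show ((Θ.symm ⟨_, hmem ⟨_, hdπ⟩⟩ :
          ↥((((hy.h1 k).1.propagateStructure (S.t k).cond).modify (transverseStructure p S.ρbar S.jbar)
            ∅ ∅ n).selmerGroup)) : galoisCohomology S.ρbar 1) = e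
      rw [hA, AddEquiv.symm_apply_apply]
  haveI : RingHomSurjective (algebraMap R (Rk k)) := ⟨hy.algebraMap_surjective k⟩
  apply WithBot.coe_injective
  rw [Module.coe_length, Module.coe_length]
  exact Order.krullDim_eq_of_orderIso (Submodule.orderIsoMapComapOfBijective f hf)

/-! ## §2 `H¹_{F̄(n)}(K, T̄) = H¹_{F̄(n)}(K, T̄)⁺ ⊕ H¹_{F̄(n)}(K, T̄)⁻` and the lengths add -/

/-- **`𝓗̄(n)⁺ ⊓ 𝓗̄(n)⁻ = 0`**: a class with `τ_* c = c` and `τ_* c = -c` is killed by `2` and by the odd prime `p`, hence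
is `0`. [cite: Howard2004HeegnerKolyvagin, §1.5 preamble and Def. 1.5.2 (arXiv:1202.6340 p. 9 L122–126, L133–138)] -/
theorem disjoint_residualSelmer_eigen (S : DVRSetting p K R N Rk Nbar Nq) (hy : S.SatisfiesH) (k : ℕ)
    (n : Finset (HeightOneSpectrum (𝓞 K))) :
    letI := galoisCohomology.moduleH1 S.ρbar (S.isScalarLinear_rhobar hy k)
    Disjoint
      (galoisCohomology.submoduleOfStable (S.isScalarLinear_rhobar hy k)
        ((((hy.h1 k).1.propagateStructure (S.t k).cond).modify (transverseStructure p S.ρbar S.jbar)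
            ∅ ∅ n).selmerGroup ⊓
          (semilinearH S.cd.isLift (S.A k).θ.toAddMonoidHom (S.A k).isSemilinear 1 - AddMonoidHom.id _).ker)
        (S.scalarMapH1_mem_residualSelmer_inf_ker_sub hy k ∅ ∅ n))
      (galoisCohomology.submoduleOfStable (S.isScalarLinear_rhobar hy k)
        ((((hy.h1 k).1.propagateStructure (S.t k).cond).modify (transverseStructure p S.ρbar S.jbar)
            ∅ ∅ n).selmerGroup ⊓
          (semilinearH S.cd.isLift (S.A k).θ.toAddMonoidHom (S.A k).isSemilinear 1 + AddMonoidHom.id _).ker)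
        (S.scalarMapH1_mem_residualSelmer_inf_ker_add hy k ∅ ∅ n)) := by
  letI instRk := galoisCohomology.moduleH1 S.ρbar (S.isScalarLinear_rhobar hy k)
  rw [Submodule.disjoint_def]
  intro c hcp hcm
  rw [galoisCohomology.mem_submoduleOfStable_iff, AddSubgroup.mem_inf, AddMonoidHom.mem_ker,
    AddMonoidHom.sub_apply, AddMonoidHom.id_apply, sub_eq_zero] at hcp
  rw [galoisCohomology.mem_submoduleOfStable_iff, AddSubgroup.mem_inf, AddMonoidHom.mem_ker,
    AddMonoidHom.add_apply, AddMonoidHom.id_apply] at hcm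
  have h2 : (2 : ℕ) • c = 0 := by
    rw [two_nsmul]
    have h := hcm.2
    rwa [hcp.2] at h
  have hp : p.Prime := Fact.out
  obtain ⟨m, hm⟩ : Odd p := hp.odd_of_ne_two hy.p_odd
  have hc : c = (m + 1) • ((2 : ℕ) • c) := by
    rw [smul_smul, show (m + 1) * 2 = p + 1 by omega, add_nsmul, one_nsmul,
      S.p_nsmul_galoisCohomology_rhobar_eq_zero hy c, zero_add]
  rw [hc, h2, smul_zero]

/-- **`𝓗̄(n) = 𝓗̄(n)⁺ ⊔ 𝓗̄(n)⁻`** for `n ⊆ 𝓛` (σ-fixed primes): every class splits as `c = c⁺ + c⁻` inside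
`H¹_{F̄(n)}(K, T̄)` (`exists_eigen_decomposition_mem`, `p` odd).
[cite: Howard2004HeegnerKolyvagin, §1.5 preamble and Def. 1.5.2 (arXiv:1202.6340 p. 9 L122–126, L133–138)] -/
theorem residualSelmer_eigen_sup_eq (S : DVRSetting p K R N Rk Nbar Nq) (hy : S.SatisfiesH) (k : ℕ)
    (n : Finset (HeightOneSpectrum (𝓞 K))) (hn : ↑n ⊆ S.L) :
    letI := galoisCohomology.moduleH1 S.ρbar (S.isScalarLinear_rhobar hy k)
    galoisCohomology.submoduleOfStable (S.isScalarLinear_rhobar hy k)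
        ((((hy.h1 k).1.propagateStructure (S.t k).cond).modify (transverseStructure p S.ρbar S.jbar)
            ∅ ∅ n).selmerGroup ⊓
          (semilinearH S.cd.isLift (S.A k).θ.toAddMonoidHom (S.A k).isSemilinear 1 - AddMonoidHom.id _).ker)
        (S.scalarMapH1_mem_residualSelmer_inf_ker_sub hy k ∅ ∅ n) ⊔
      galoisCohomology.submoduleOfStable (S.isScalarLinear_rhobar hy k)
        ((((hy.h1 k).1.propagateStructure (S.t k).cond).modify (transverseStructure p S.ρbar S.jbar)
            ∅ ∅ n).selmerGroup ⊓
          (semilinearH S.cd.isLift (S.A k).θ.toAddMonoidHom (S.A k).isSemilinear 1 + AddMonoidHom.id _).ker)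
        (S.scalarMapH1_mem_residualSelmer_inf_ker_add hy k ∅ ∅ n) =
      galoisCohomology.submoduleOfStable (S.isScalarLinear_rhobar hy k)
        ((((hy.h1 k).1.propagateStructure (S.t k).cond).modify (transverseStructure p S.ρbar S.jbar)
          ∅ ∅ n).selmerGroup)
        (S.scalarMapH1_mem_residualSelmer_modify hy k ∅ ∅ n) := by
  letI instRk := galoisCohomology.moduleH1 S.ρbar (S.isScalarLinear_rhobar hy k)
  have hnσ : ∀ w ∈ n, S.cd.σ • w = w := fun w hw => S.sigma_smul_eq_self_of_mem_L hy (hn hw)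
  have h0σ : ∀ w ∈ (∅ : Finset (HeightOneSpectrum (𝓞 K))), S.cd.σ • w = w := fun w hw => absurd hw (by simp)
  apply le_antisymm
  · exact sup_le (fun c hc => hc.1) (fun c hc => hc.1)
  · intro c hc
    rw [galoisCohomology.mem_submoduleOfStable_iff] at hc
    obtain ⟨cp, cm, hcp, hcm, hτp, hτm, rfl⟩ := S.exists_eigen_decomposition_mem hy k h0σ hnσ hc
    refine Submodule.add_mem_sup ?_ ?_
    · rw [galoisCohomology.mem_submoduleOfStable_iff, AddSubgroup.mem_inf, AddMonoidHom.mem_ker,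
        AddMonoidHom.sub_apply, AddMonoidHom.id_apply, hτp, sub_self]
      exact ⟨hcp, rfl⟩
    · rw [galoisCohomology.mem_submoduleOfStable_iff, AddSubgroup.mem_inf, AddMonoidHom.mem_ker,
        AddMonoidHom.add_apply, AddMonoidHom.id_apply, hτm, neg_add_cancel]
      exact ⟨hcm, rfl⟩

/-- **`ρ(n) = ρ(n)⁺ + ρ(n)⁻` as lengths**: `len_{R_k} H¹_{F̄(n)}(K, T̄) = len_{R_k} H¹_{F̄(n)}(K, T̄)⁺ + len_{R_k} H¹_{F̄(n)}(K, T̄)⁻`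
for `n ⊆ 𝓛` (the eigen-splitting is an internal direct sum). [cite: Howard2004HeegnerKolyvagin, Def. 1.5.2 (arXiv:1202.6340 p. 9 L133–138: «`ρ(n) = ρ(n)⁺ + ρ(n)⁻`»)] -/
theorem length_residualSelmer_eq_add (S : DVRSetting p K R N Rk Nbar Nq) (hy : S.SatisfiesH) (k : ℕ)
    (n : Finset (HeightOneSpectrum (𝓞 K))) (hn : ↑n ⊆ S.L) :
    letI := galoisCohomology.moduleH1 S.ρbar (S.isScalarLinear_rhobar hy k)
    Module.length (Rk k) ↥(galoisCohomology.submoduleOfStable (S.isScalarLinear_rhobar hy k)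
        ((((hy.h1 k).1.propagateStructure (S.t k).cond).modify (transverseStructure p S.ρbar S.jbar)
          ∅ ∅ n).selmerGroup)
        (S.scalarMapH1_mem_residualSelmer_modify hy k ∅ ∅ n)) =
      Module.length (Rk k) ↥(galoisCohomology.submoduleOfStable (S.isScalarLinear_rhobar hy k)
        ((((hy.h1 k).1.propagateStructure (S.t k).cond).modify (transverseStructure p S.ρbar S.jbar)
            ∅ ∅ n).selmerGroup ⊓
          (semilinearH S.cd.isLift (S.A k).θ.toAddMonoidHom (S.A k).isSemilinear 1 - AddMonoidHom.id _).ker)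
        (S.scalarMapH1_mem_residualSelmer_inf_ker_sub hy k ∅ ∅ n)) +
      Module.length (Rk k) ↥(galoisCohomology.submoduleOfStable (S.isScalarLinear_rhobar hy k)
        ((((hy.h1 k).1.propagateStructure (S.t k).cond).modify (transverseStructure p S.ρbar S.jbar)
            ∅ ∅ n).selmerGroup ⊓
          (semilinearH S.cd.isLift (S.A k).θ.toAddMonoidHom (S.A k).isSemilinear 1 + AddMonoidHom.id _).ker)
        (S.scalarMapH1_mem_residualSelmer_inf_ker_add hy k ∅ ∅ n)) := by
  letI instRk := galoisCohomology.moduleH1 S.ρbar (S.isScalarLinear_rhobar hy k)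
  rw [← (LinearEquiv.ofEq _ _ (S.residualSelmer_eigen_sup_eq hy k n hn)).length_eq]
  exact length_sup_eq_add_of_disjoint _ _ (S.disjoint_residualSelmer_eigen hy k n)

/-! ## §3 The ρ-identity `len_R H¹_{F(n)}(K, T^{(k)})[π] = ρ(n)⁺ + ρ(n)⁻` -/

/-- **The ρ-IDENTITY on the level module** (Howard's «`ρ(n)` is the `R/𝔪`-dimension of `H¹_{F(n)}(K, T^{(k)})[𝔪]`»
with «`ρ(n) = ρ(n)⁺ + ρ(n)⁻`»), for `n ⊆ 𝓛^{(2k-1)}`, in `ℕ∞` and unconditional: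
`len_R H¹_{F(n)}(K, T^{(k)})[π] = len_{R_k} H¹_{F̄(n)}(K, T̄)⁺ + len_{R_k} H¹_{F̄(n)}(K, T̄)⁻`.
[cite: Howard2004HeegnerKolyvagin, Def. 1.5.2 and Lemma 1.6.4 proof (arXiv:1202.6340 p. 9 L133–138, p. 11 L95–97)] -/
theorem length_torsionBy_selmerModuleAt_eq (S : DVRSetting p K R N Rk Nbar Nq) (hy : S.SatisfiesH) (k : ℕ)
    (n : Finset (HeightOneSpectrum (𝓞 K))) (hn : ↑n ⊆ S.enginePrimes k) :
    letI := galoisCohomology.moduleH1 (S.T.ρ k) (S.T.hlin k)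
    letI := galoisCohomology.moduleH1 S.ρbar (S.isScalarLinear_rhobar hy k)
    Module.length R ↥(torsionBy R ↥(S.selmerModuleAt hy k n) S.π) =
      Module.length (Rk k) ↥(galoisCohomology.submoduleOfStable (S.isScalarLinear_rhobar hy k)
        ((((hy.h1 k).1.propagateStructure (S.t k).cond).modify (transverseStructure p S.ρbar S.jbar)
            ∅ ∅ n).selmerGroup ⊓
          (semilinearH S.cd.isLift (S.A k).θ.toAddMonoidHom (S.A k).isSemilinear 1 - AddMonoidHom.id _).ker)
        (S.scalarMapH1_mem_residualSelmer_inf_ker_sub hy k ∅ ∅ n)) +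
      Module.length (Rk k) ↥(galoisCohomology.submoduleOfStable (S.isScalarLinear_rhobar hy k)
        ((((hy.h1 k).1.propagateStructure (S.t k).cond).modify (transverseStructure p S.ρbar S.jbar)
            ∅ ∅ n).selmerGroup ⊓
          (semilinearH S.cd.isLift (S.A k).θ.toAddMonoidHom (S.A k).isSemilinear 1 + AddMonoidHom.id _).ker)
        (S.scalarMapH1_mem_residualSelmer_inf_ker_add hy k ∅ ∅ n)) := by
  rw [S.length_torsionBy_selmerModuleAt_eq_length_residualSelmer hy k n hn]
  exact S.length_residualSelmer_eq_add hy k n (hn.trans (S.enginePrimes_subset_L k))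

/-! ## §4 The engine letters: `dim_{R/(π)} H¹_{F(n)}(K,T^{(k)})[π] = ρ⁺ k n + ρ⁻ k n` and `hsmall` -/

/-- **`dim_{R/(π)} H¹_{F(n)}(K, T^{(k)})[π] = ρ⁺(n) + ρ⁻(n)`** for any `ℕ`-valued letters `ρ±` equal, at the sets
`n ⊆ 𝓛^{(2k-1)}`, to the `R_k`-lengths of the `τ`-eigenparts of `H¹_{F̄(n)}(K, T̄)` (the ENGINE's `ρp`, `ρm`): Howard's
`ρ(n) = dim_{R/𝔪} H¹_{F(n)}(K, T^{(k)})[𝔪]` in the currency of `hsmall_of_finrank_le` / Prop. 1.5.5's `ε`-parity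
(`finrank` over the residue field `R/(π)` is the `toNat` of the length, `length_eq_rank`).
[cite: Howard2004HeegnerKolyvagin, Def. 1.5.2 and Lemma 1.6.4 proof (arXiv:1202.6340 p. 9 L133–138, p. 11 L95–97, p. 12 L10–13)] -/
theorem finrank_torsionBy_selmerModuleAt_eq_add (S : DVRSetting p K R N Rk Nbar Nq) (hy : S.SatisfiesH)
    (ρp ρm : ℕ → Finset (HeightOneSpectrum (𝓞 K)) → ℕ)
    (hρp : ∀ (k : ℕ) (n : Finset (HeightOneSpectrum (𝓞 K))), ↑n ⊆ S.enginePrimes k →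
      letI := galoisCohomology.moduleH1 S.ρbar (S.isScalarLinear_rhobar hy k)
      (ρp k n : ℕ∞) = Module.length (Rk k) ↥(galoisCohomology.submoduleOfStable (S.isScalarLinear_rhobar hy k)
        ((((hy.h1 k).1.propagateStructure (S.t k).cond).modify (transverseStructure p S.ρbar S.jbar)
            ∅ ∅ n).selmerGroup ⊓
          (semilinearH S.cd.isLift (S.A k).θ.toAddMonoidHom (S.A k).isSemilinear 1 - AddMonoidHom.id _).ker)
        (S.scalarMapH1_mem_residualSelmer_inf_ker_sub hy k ∅ ∅ n)))
    (hρm : ∀ (k : ℕ) (n : Finset (HeightOneSpectrum (𝓞 K))), ↑n ⊆ S.enginePrimes k →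
      letI := galoisCohomology.moduleH1 S.ρbar (S.isScalarLinear_rhobar hy k)
      (ρm k n : ℕ∞) = Module.length (Rk k) ↥(galoisCohomology.submoduleOfStable (S.isScalarLinear_rhobar hy k)
        ((((hy.h1 k).1.propagateStructure (S.t k).cond).modify (transverseStructure p S.ρbar S.jbar)
            ∅ ∅ n).selmerGroup ⊓
          (semilinearH S.cd.isLift (S.A k).θ.toAddMonoidHom (S.A k).isSemilinear 1 + AddMonoidHom.id _).ker)
        (S.scalarMapH1_mem_residualSelmer_inf_ker_add hy k ∅ ∅ n)))
    (k : ℕ) (n : Finset (HeightOneSpectrum (𝓞 K))) (hn : ↑n ⊆ S.enginePrimes k) :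
    letI := galoisCohomology.moduleH1 (S.T.ρ k) (S.T.hlin k)
    Module.finrank (R ⧸ R ∙ S.π) ↥(torsionBy R ↥(S.selmerModuleAt hy k n) S.π) = ρp k n + ρm k n := by
  letI instR := galoisCohomology.moduleH1 (S.T.ρ k) (S.T.hlin k)
  have hlen := S.length_torsionBy_selmerModuleAt_eq hy k n hn
  rw [← hρp k n hn, ← hρm k n hn, ← Nat.cast_add] at hlen
  have hϖ : Irreducible S.π := (IsDiscreteValuationRing.irreducible_iff_uniformizer S.π).mpr hy.unif
  haveI : Ideal.IsMaximal (R ∙ S.π) := PrincipalIdealRing.isMaximal_of_irreducible hϖ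
  letI : Field (R ⧸ R ∙ S.π) := Ideal.Quotient.field (R ∙ S.π)
  rw [Module.length_eq_of_surjective (S := R) (R := R ⧸ R ∙ S.π)
    (M := ↥(torsionBy R ↥(S.selmerModuleAt hy k n) S.π)) Ideal.Quotient.mk_surjective,
    Module.length_eq_rank] at hlen
  have h := congrArg ENat.toNat hlen
  rw [Cardinal.toNat_toENat, ENat.toNat_coe] at h
  exact h

/-- **The ENGINE hypothesis `hsmall`, verbatim, DISCHARGED for the eigen-length letters `ρ±`**:
`∀ k n, ↑n ⊆ 𝓛^{(2k−1)} → ρ⁺ k n + ρ⁻ k n ≤ 1 → Stub^{(k)}(n) = ⊤` — «`ρ(n) = 0` or `1` implies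
`Stub^{(k)}(n) = H¹_{𝓕(n)}(K, T^{(k)})`» (`hsmall_of_finrank_le` with `finrank_torsionBy_selmerModuleAt_eq_add`).
[cite: Howard2004HeegnerKolyvagin, Lemma 1.6.4 (proof) (arXiv:1202.6340 p. 12 L10–13)] -/
theorem hsmall_of_eigenLengths (S : DVRSetting p K R N Rk Nbar Nq) (hy : S.SatisfiesH)
    (hdec : S.HasLevelDecompositions hy) (ρp ρm : ℕ → Finset (HeightOneSpectrum (𝓞 K)) → ℕ)
    (hρp : ∀ (k : ℕ) (n : Finset (HeightOneSpectrum (𝓞 K))), ↑n ⊆ S.enginePrimes k →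
      letI := galoisCohomology.moduleH1 S.ρbar (S.isScalarLinear_rhobar hy k)
      (ρp k n : ℕ∞) = Module.length (Rk k) ↥(galoisCohomology.submoduleOfStable (S.isScalarLinear_rhobar hy k)
        ((((hy.h1 k).1.propagateStructure (S.t k).cond).modify (transverseStructure p S.ρbar S.jbar)
            ∅ ∅ n).selmerGroup ⊓
          (semilinearH S.cd.isLift (S.A k).θ.toAddMonoidHom (S.A k).isSemilinear 1 - AddMonoidHom.id _).ker)
        (S.scalarMapH1_mem_residualSelmer_inf_ker_sub hy k ∅ ∅ n)))
    (hρm : ∀ (k : ℕ) (n : Finset (HeightOneSpectrum (𝓞 K))), ↑n ⊆ S.enginePrimes k →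
      letI := galoisCohomology.moduleH1 S.ρbar (S.isScalarLinear_rhobar hy k)
      (ρm k n : ℕ∞) = Module.length (Rk k) ↥(galoisCohomology.submoduleOfStable (S.isScalarLinear_rhobar hy k)
        ((((hy.h1 k).1.propagateStructure (S.t k).cond).modify (transverseStructure p S.ρbar S.jbar)
            ∅ ∅ n).selmerGroup ⊓
          (semilinearH S.cd.isLift (S.A k).θ.toAddMonoidHom (S.A k).isSemilinear 1 + AddMonoidHom.id _).ker)
        (S.scalarMapH1_mem_residualSelmer_inf_ker_add hy k ∅ ∅ n))) :
    ∀ (k : ℕ) (n : Finset (HeightOneSpectrum (𝓞 K))), ↑n ⊆ S.enginePrimes k → ρp k n + ρm k n ≤ 1 →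
      S.stub hy hdec k n = ⊤ :=
  S.hsmall_of_finrank_le hy hdec ρp ρm fun k n hn =>
    (S.finrank_torsionBy_selmerModuleAt_eq_add hy ρp ρm hρp hρm k n hn).le

/-! ## §5 Finiteness of the counts and the `ℕ`-valued letters `ρ±`

Under `HasLevelDecompositions` (Thm. 1.4.2's decompositions, the ENGINE's `hdec`) the level Selmer group is finite, so
`len_R H¹_{F(n)}(K,T^{(k)})[π] < ∞` (`length_torsionBy_selmerModuleAt_ne_top`) and, by §3, both eigen-lengths are finite
(`length_residualSelmer_eigen_ne_top`); hence there ARE `ℕ`-valued letters `ρ± k n` with `(ρ± k n : ℕ∞) = len 𝓗̄(n)^±`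
on every `n ⊆ 𝓛^{(2k-1)}` (`exists_eigenLengths` — the functions the ENGINE's `hsmall`/`hchebI`/`hchebII` and
Prop. 1.5.5's parity quantify over), and `hsmall` comes attached (`exists_eigenLengths_hsmall`). -/

/-- **`len_R H¹_{F(n)}(K, T^{(k)})[π] < ∞`** for `n ⊆ 𝓛^{(2k-1)}` once the level Selmer group carries a decomposition
`H¹_{F(n)}(K,T^{(k)}) ≅ (R/𝔪^{e_k})^ε ⊕ M ⊕ M` with `M` finite (Thm. 1.4.2, `HasLevelDecompositions`): the level Selmer
group is then finite (finite residue field, `R/𝔪^{e_k}` finite), so is its `π`-torsion, which has finite length.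
[cite: Howard2004HeegnerKolyvagin, Thm. 1.4.2 and Lemma 1.6.4 proof (arXiv:1202.6340 p. 8 L99–105, p. 11 L95–97)] -/
theorem length_torsionBy_selmerModuleAt_ne_top (S : DVRSetting p K R N Rk Nbar Nq) (hy : S.SatisfiesH)
    (hdec : S.HasLevelDecompositions hy) (k : ℕ) (n : Finset (HeightOneSpectrum (𝓞 K)))
    (hn : ↑n ⊆ S.enginePrimes k) :
    letI := galoisCohomology.moduleH1 (S.T.ρ k) (S.T.hlin k)
    Module.length R ↥(torsionBy R ↥(S.selmerModuleAt hy k n) S.π) ≠ ⊤ := by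
  letI instR := galoisCohomology.moduleH1 (S.T.ρ k) (S.T.hlin k)
  obtain ⟨ε, -, M, _, _, _, ⟨e⟩, -, -⟩ := S.exists_linearEquiv_decomposition hy hdec k n hn
  haveI : Finite (IsLocalRing.ResidueField R) := hy.coeffRing.finite_residueField
  haveI : Finite (R ⧸ IsLocalRing.maximalIdeal R ^ S.e k) :=
    CompleteLocalRing.finite_quotient_maximalIdeal_pow (R := R) (S.e k)
  haveI : Finite ↥(S.selmerModuleAt hy k n) := Finite.of_equiv _ e.toEquiv.symm
  haveI : IsArtinian R ↥(torsionBy R ↥(S.selmerModuleAt hy k n) S.π) := isArtinian_of_finite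
  exact Module.length_ne_top

/-- **`ρ(n)^± < ∞`**: the `R_k`-lengths of the `τ`-eigenparts of `H¹_{F̄(n)}(K, T̄)` are finite for `n ⊆ 𝓛^{(2k-1)}` (they
are bounded by `len H¹_{F̄(n)}(K, T̄) = len H¹_{F(n)}(K, T^{(k)})[π] < ∞`), under `HasLevelDecompositions`.
[cite: Howard2004HeegnerKolyvagin, Def. 1.5.2 (arXiv:1202.6340 p. 9 L133–138: «the `R/𝔪`-dimension of `𝓗̄(n)^±`»)] -/
theorem length_residualSelmer_eigen_ne_top (S : DVRSetting p K R N Rk Nbar Nq) (hy : S.SatisfiesH)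
    (hdec : S.HasLevelDecompositions hy) (k : ℕ) (n : Finset (HeightOneSpectrum (𝓞 K)))
    (hn : ↑n ⊆ S.enginePrimes k) :
    letI := galoisCohomology.moduleH1 S.ρbar (S.isScalarLinear_rhobar hy k)
    Module.length (Rk k) ↥(galoisCohomology.submoduleOfStable (S.isScalarLinear_rhobar hy k)
        ((((hy.h1 k).1.propagateStructure (S.t k).cond).modify (transverseStructure p S.ρbar S.jbar)
            ∅ ∅ n).selmerGroup ⊓
          (semilinearH S.cd.isLift (S.A k).θ.toAddMonoidHom (S.A k).isSemilinear 1 - AddMonoidHom.id _).ker)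
        (S.scalarMapH1_mem_residualSelmer_inf_ker_sub hy k ∅ ∅ n)) ≠ ⊤ ∧
    Module.length (Rk k) ↥(galoisCohomology.submoduleOfStable (S.isScalarLinear_rhobar hy k)
        ((((hy.h1 k).1.propagateStructure (S.t k).cond).modify (transverseStructure p S.ρbar S.jbar)
            ∅ ∅ n).selmerGroup ⊓
          (semilinearH S.cd.isLift (S.A k).θ.toAddMonoidHom (S.A k).isSemilinear 1 + AddMonoidHom.id _).ker)
        (S.scalarMapH1_mem_residualSelmer_inf_ker_add hy k ∅ ∅ n)) ≠ ⊤ := by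
  letI instRk := galoisCohomology.moduleH1 S.ρbar (S.isScalarLinear_rhobar hy k)
  have htot := S.length_torsionBy_selmerModuleAt_ne_top hy hdec k n hn
  rw [S.length_torsionBy_selmerModuleAt_eq hy k n hn] at htot
  exact ⟨ne_top_of_le_ne_top htot le_self_add, ne_top_of_le_ne_top htot le_add_self⟩

/-- **The `ℕ`-valued eigen-counts `ρ⁺, ρ⁻` exist** (under `HasLevelDecompositions`): functions
`ρ± : ℕ → Finset _ → ℕ` with `(ρ± k n : ℕ∞) = len_{R_k} H¹_{F̄(n)}(K, T̄)^±` at every `n ⊆ 𝓛^{(2k-1)}` — Howard's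
`ρ(n)^± = dim_{R/𝔪} 𝓗̄(n)^±` in the letter shape the ENGINE's `hsmall` / `hchebI` / `hchebII` and Prop. 1.5.5 consume.
[cite: Howard2004HeegnerKolyvagin, Def. 1.5.2 (arXiv:1202.6340 p. 9 L133–138)] -/
theorem exists_eigenLengths (S : DVRSetting p K R N Rk Nbar Nq) (hy : S.SatisfiesH)
    (hdec : S.HasLevelDecompositions hy) :
    ∃ ρp ρm : ℕ → Finset (HeightOneSpectrum (𝓞 K)) → ℕ,
      (∀ (k : ℕ) (n : Finset (HeightOneSpectrum (𝓞 K))), ↑n ⊆ S.enginePrimes k →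
        letI := galoisCohomology.moduleH1 S.ρbar (S.isScalarLinear_rhobar hy k)
        (ρp k n : ℕ∞) = Module.length (Rk k) ↥(galoisCohomology.submoduleOfStable (S.isScalarLinear_rhobar hy k)
          ((((hy.h1 k).1.propagateStructure (S.t k).cond).modify (transverseStructure p S.ρbar S.jbar)
              ∅ ∅ n).selmerGroup ⊓
            (semilinearH S.cd.isLift (S.A k).θ.toAddMonoidHom (S.A k).isSemilinear 1 - AddMonoidHom.id _).ker)
          (S.scalarMapH1_mem_residualSelmer_inf_ker_sub hy k ∅ ∅ n))) ∧
      (∀ (k : ℕ) (n : Finset (HeightOneSpectrum (𝓞 K))), ↑n ⊆ S.enginePrimes k →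
        letI := galoisCohomology.moduleH1 S.ρbar (S.isScalarLinear_rhobar hy k)
        (ρm k n : ℕ∞) = Module.length (Rk k) ↥(galoisCohomology.submoduleOfStable (S.isScalarLinear_rhobar hy k)
          ((((hy.h1 k).1.propagateStructure (S.t k).cond).modify (transverseStructure p S.ρbar S.jbar)
              ∅ ∅ n).selmerGroup ⊓
            (semilinearH S.cd.isLift (S.A k).θ.toAddMonoidHom (S.A k).isSemilinear 1 + AddMonoidHom.id _).ker)
          (S.scalarMapH1_mem_residualSelmer_inf_ker_add hy k ∅ ∅ n))) := by
  refine ⟨fun k n =>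
      letI := galoisCohomology.moduleH1 S.ρbar (S.isScalarLinear_rhobar hy k)
      (Module.length (Rk k) ↥(galoisCohomology.submoduleOfStable (S.isScalarLinear_rhobar hy k)
        ((((hy.h1 k).1.propagateStructure (S.t k).cond).modify (transverseStructure p S.ρbar S.jbar)
            ∅ ∅ n).selmerGroup ⊓
          (semilinearH S.cd.isLift (S.A k).θ.toAddMonoidHom (S.A k).isSemilinear 1 - AddMonoidHom.id _).ker)
        (S.scalarMapH1_mem_residualSelmer_inf_ker_sub hy k ∅ ∅ n))).toNat,
    fun k n =>
      letI := galoisCohomology.moduleH1 S.ρbar (S.isScalarLinear_rhobar hy k)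
      (Module.length (Rk k) ↥(galoisCohomology.submoduleOfStable (S.isScalarLinear_rhobar hy k)
        ((((hy.h1 k).1.propagateStructure (S.t k).cond).modify (transverseStructure p S.ρbar S.jbar)
            ∅ ∅ n).selmerGroup ⊓
          (semilinearH S.cd.isLift (S.A k).θ.toAddMonoidHom (S.A k).isSemilinear 1 + AddMonoidHom.id _).ker)
        (S.scalarMapH1_mem_residualSelmer_inf_ker_add hy k ∅ ∅ n))).toNat,
    fun k n hn => ?_, fun k n hn => ?_⟩
  · exact ENat.coe_toNat (S.length_residualSelmer_eigen_ne_top hy hdec k n hn).1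
  · exact ENat.coe_toNat (S.length_residualSelmer_eigen_ne_top hy hdec k n hn).2

/-- **The ENGINE hypothesis `hsmall` holds for SOME eigen-count letters `ρ±`** (the ones of `exists_eigenLengths`),
on any `DVRSetting` with H.0–H.5 and level decompositions: «`ρ(n) = 0` or `1` implies `Stub^{(k)}(n) = H¹_{𝓕(n)}(K, T^{(k)})`».
[cite: Howard2004HeegnerKolyvagin, Lemma 1.6.4 (proof) (arXiv:1202.6340 p. 12 L10–13)] -/
theorem exists_eigenLengths_hsmall (S : DVRSetting p K R N Rk Nbar Nq) (hy : S.SatisfiesH)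
    (hdec : S.HasLevelDecompositions hy) :
    ∃ ρp ρm : ℕ → Finset (HeightOneSpectrum (𝓞 K)) → ℕ,
      (∀ (k : ℕ) (n : Finset (HeightOneSpectrum (𝓞 K))), ↑n ⊆ S.enginePrimes k →
        letI := galoisCohomology.moduleH1 S.ρbar (S.isScalarLinear_rhobar hy k)
        (ρp k n : ℕ∞) = Module.length (Rk k) ↥(galoisCohomology.submoduleOfStable (S.isScalarLinear_rhobar hy k)
          ((((hy.h1 k).1.propagateStructure (S.t k).cond).modify (transverseStructure p S.ρbar S.jbar)
              ∅ ∅ n).selmerGroup ⊓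
            (semilinearH S.cd.isLift (S.A k).θ.toAddMonoidHom (S.A k).isSemilinear 1 - AddMonoidHom.id _).ker)
          (S.scalarMapH1_mem_residualSelmer_inf_ker_sub hy k ∅ ∅ n))) ∧
      (∀ (k : ℕ) (n : Finset (HeightOneSpectrum (𝓞 K))), ↑n ⊆ S.enginePrimes k →
        letI := galoisCohomology.moduleH1 S.ρbar (S.isScalarLinear_rhobar hy k)
        (ρm k n : ℕ∞) = Module.length (Rk k) ↥(galoisCohomology.submoduleOfStable (S.isScalarLinear_rhobar hy k)
          ((((hy.h1 k).1.propagateStructure (S.t k).cond).modify (transverseStructure p S.ρbar S.jbar)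
              ∅ ∅ n).selmerGroup ⊓
            (semilinearH S.cd.isLift (S.A k).θ.toAddMonoidHom (S.A k).isSemilinear 1 + AddMonoidHom.id _).ker)
          (S.scalarMapH1_mem_residualSelmer_inf_ker_add hy k ∅ ∅ n))) ∧
      (∀ (k : ℕ) (n : Finset (HeightOneSpectrum (𝓞 K))), ↑n ⊆ S.enginePrimes k → ρp k n + ρm k n ≤ 1 →
        S.stub hy hdec k n = ⊤) := by
  obtain ⟨ρp, ρm, hρp, hρm⟩ := S.exists_eigenLengths hy hdec
  exact ⟨ρp, ρm, hρp, hρm, S.hsmall_of_eigenLengths hy hdec ρp ρm hρp hρm⟩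

end DVRSetting

end Literature.NumberTheory.GaloisCohomology.Howard2004

end
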